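import Literature.AlgebraicGeometry.Motives.ShearCocycleResidueAtSlice
import HarnessLib

/-!
# The shear identity `Φ^*(pr₂^*θ) = pr₂^*θ` for the invariant top form (road W, (W0) L4c′ — the closer)

Topic `Literature/AlgebraicGeometry/Motives`, namespace `Literature.AlgebraicGeometry.Motives`.  THEOREMS ONLY.  Cell
`hodgecm-mathlib` (D-0151), fan B-III (T1) road W, sub-line `koizumi_strictly_local`, node (W0) (B-p18's
`SmoothProperModelBirationalGroupLawCore`), leaf L4c′: the ONE-NAME CLOSER `shear_identity` — the conclusion of `stub_L4c'` verbatim with no residual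
hypothesis: ★ `shear_identity_of_residue_eq_one` (constancy + evaluation on the proper generic fibre, B-p12) fed with
★ `exists_germ_shearCocycle_residue_eq_one_unitPoint` (the residue at `(ε, ε)` is `1`, B-p01, on the unit slice
★ `exists_unitSlice_liftD`, B-p12) and the seam ★ `isUnitAt_shearCocycle_of_mem_genericFibre` (B-p01).

Banked leaf toward road W (r₀); no floor change (HC_CM is proved only modulo the printed citations until rung 0
closes).

## References
* S. Bosch, W. Lütkebohmert, M. Raynaud, *Néron Models* (1990), §4.2 Prop. 1–2 (invariant differentials), §4.3
  Prop. 2 (the shear and the relative top form). [BLRNeronModels1990]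
* B. Edixhoven, M. Romagny, *Group schemes out of birational group laws, Néron models* (2012), Thm. 6.3 (proof).
  [EdixhovenRomagny2012]
-/

noncomputable section

universe u

open CategoryTheory CategoryTheory.Limits AlgebraicGeometry MonoidalCategory CartesianMonoidalCategory
open Literature.NumberTheory.EllipticCurves Literature.AlgebraicGeometry.Motives
open Literature.AlgebraicGeometry.Motives.RatFn Literature.AlgebraicGeometry.Smoothening
open scoped MonObj CategoryTheory.Obj

namespace Literature.AlgebraicGeometry.Motives

variable {R : Type u} [CommRing R] [IsDomain R] [IsDiscreteValuationRing R]
  {K : Type u} [Field K] [Algebra R K] [IsFractionRing R K] [IsOpenImmersion (specGenericPoint R K)]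
  (𝒳 : Over (Spec (.of R))) [IsProper 𝒳.hom] [IsIntegral 𝒳.left] [IsIntegral (𝒳 ⊗ 𝒳).left]
  [IsDominant (fst 𝒳 𝒳).left] [IsDominant (snd 𝒳 𝒳).left] (n : ℕ) [SmoothOfRelativeDimension n 𝒳.hom]
  (E : Over (Spec (.of K))) [MonObj E] (e : (genericFibre R K).obj 𝒳 ≅ E)
  [Algebra R 𝒳.left.functionField] [Algebra 𝒳.left.functionField (𝒳 ⊗ 𝒳).left.functionField]

/-- **The shear identity `Φ^*(pr₂^*θ) = pr₂^*θ` for the invariant top form** — the conclusion of the (W0) core's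
`stub_L4c'` VERBATIM, with no residual hypothesis: in `K(𝒳 ×_R 𝒳)`,
`σ(pr₂♯ f₀) · B₂.det (d σ(pr₂♯ yᵢ))ᵢ = pr₂♯ f₀`, where `σ = Φ♯` is the action of the shear `Φ = (pr₁, m)` and
`θ = f₀ · dy₁ ∧ … ∧ dyₙ` is the top form on `𝒳` induced (through `e : 𝒳_K ≅ E`) by an invariant form — i.e. the
cocycle `c = Φ^*(pr₂^*θ)/pr₂^*θ` is `1`: it is a unit along the generic fibre (★ seam), has residue `1` at `(ε, ε)`
(★ `exists_germ_shearCocycle_residue_eq_one_unitPoint`), and the generic fibre is proper and geometrically integral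
(★ `shear_identity_of_residue_eq_one`).  Setting: `R` a dvr with fraction field `K`, `𝒳 → Spec R` proper with
`𝒳`, `𝒳 ×_R 𝒳` integral, smooth of relative dimension `n`.
[cite: BLRNeronModels1990, §4.2 Prop. 2, §4.3 Prop. 2] [cite: EdixhovenRomagny2012, Thm. 6.3 (proof)] -/
theorem shear_identity
    (hRL : algebraMap R 𝒳.left.functionField = stalkHom 𝒳 (genericPoint 𝒳.left))
    (hLM : algebraMap 𝒳.left.functionField (𝒳 ⊗ 𝒳).left.functionField =
      functionFieldMap (fst 𝒳 𝒳).left)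
    (D : (𝒳 ⊗ 𝒳).left.Opens) [Nonempty D] [IsDominant D.ι]
    (hD : (𝒳 ⊗ 𝒳).hom ⁻¹ᵁ (specGenericPoint R K).opensRange ≤ D)
    (m : (D : Scheme.{u}) ⟶ 𝒳.left)
    (hgen : (𝒳 ⊗ 𝒳).left.homOfLE hD ≫ m =
      (IsOpenImmersion.isoOfRangeEq (pullback.fst (𝒳 ⊗ 𝒳).hom (specGenericPoint R K))
          ((𝒳 ⊗ 𝒳).hom ⁻¹ᵁ (specGenericPoint R K).opensRange).ι (by
            rw [Scheme.Opens.range_ι]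
            exact IsOpenImmersion.range_pullbackFst (specGenericPoint R K) (𝒳 ⊗ 𝒳).hom)).inv ≫
        (Functor.OplaxMonoidal.δ (genericFibre R K) 𝒳 𝒳 ≫ (e.hom ⊗ₘ e.hom) ≫ μ[E] ≫ e.inv).left ≫
        pullback.fst 𝒳.hom (specGenericPoint R K))
    (ΦD : (D : Scheme.{u}) ⟶ (𝒳 ⊗ 𝒳).left) [IsDominant ΦD]
    (hΦ₁ : ΦD ≫ (fst 𝒳 𝒳).left = D.ι ≫ (fst 𝒳 𝒳).left) (hΦ₂ : ΦD ≫ (snd 𝒳 𝒳).left = m)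
    (hisoSt : ∀ qD : ↥(D : Scheme.{u}),
      (𝒳 ⊗ 𝒳).hom.base (D.ι.base qD) ∈ Set.range (specGenericPoint R K).base →
        IsIso (ΦD.stalkMap qD))
    (σ : (𝒳 ⊗ 𝒳).left.functionField →+* (𝒳 ⊗ 𝒳).left.functionField)
    (hσ : (functionFieldMap D.ι).comp σ = functionFieldMap ΦD)
    (f₀ : 𝒳.left.functionField) (y : Fin n → 𝒳.left.functionField)
    (B₀ : Module.Basis (Fin n) 𝒳.left.functionField Ω[𝒳.left.functionField⁄R])
    (hB₀ : ∀ i, B₀ i = KaehlerDifferential.D R _ (y i))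
    (hθ : ∀ (p : 𝒳.left) (_ : 𝒳.hom.base p ∈ Set.range (specGenericPoint R K).base)
        (z : Fin n → 𝒳.left.presheaf.stalk p)
        (b : letI := (stalkHom 𝒳 p).toAlgebra
          Module.Basis (Fin n) (𝒳.left.presheaf.stalk p) Ω[𝒳.left.presheaf.stalk p⁄R])
        (_ : letI := (stalkHom 𝒳 p).toAlgebra; ∀ i, b i = KaehlerDifferential.D R _ (z i))
        (B : Module.Basis (Fin n) 𝒳.left.functionField Ω[𝒳.left.functionField⁄R])
        (_ : ∀ i, B i = KaehlerDifferential.D R _ (toFunctionField p (z i))),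
        IsUnitAt p (f₀ * B.det B₀))
    (B₂ : Module.Basis (Fin n) (𝒳 ⊗ 𝒳).left.functionField
        Ω[(𝒳 ⊗ 𝒳).left.functionField⁄𝒳.left.functionField])
    (hB₂ : ∀ i, B₂ i = KaehlerDifferential.D 𝒳.left.functionField _
        (functionFieldMap (snd 𝒳 𝒳).left (y i))) :
    σ (functionFieldMap (snd 𝒳 𝒳).left f₀) *
      B₂.det (fun i => KaehlerDifferential.D 𝒳.left.functionField _
        (σ (functionFieldMap (snd 𝒳 𝒳).left (y i)))) = functionFieldMap (snd 𝒳 𝒳).left f₀ :=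
  shear_identity_of_residue_eq_one 𝒳 E e n hRL hLM D hD ΦD hΦ₁ hisoSt σ hσ f₀ y B₀ hB₀ hθ B₂ hB₂
    (exists_germ_shearCocycle_residue_eq_one_unitPoint K 𝒳 n hRL hLM E e D hD m hgen ΦD hΦ₁ hΦ₂ hisoSt σ hσ
      f₀ y B₀ hB₀ hθ B₂ hB₂)


end Literature.AlgebraicGeometry.Motives

end
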